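import Summits.ResolutionOfSingularities.ResolutionOfSingularities.Theorems.RadicialJungCleanModelsPBasisRsopIndependent
import Summits.ResolutionOfSingularities.ResolutionOfSingularities.Theorems.RadicialJungCleanModelsPBasisRsopGenerate
import Summits.ResolutionOfSingularities.ResolutionOfSingularities.Theorems.RadicialJungCleanModelsPBasisFieldExchange
import Summits.ResolutionOfSingularities.ResolutionOfSingularities.Theorems.RadicialJungCleanModelsPBasisResidueFinite
import Literature.AlgebraicGeometry.Resolution.StrictNormalCrossingsDescent
import HarnessLib

/-!
# Route `RadicialJung`, crux `CleanModels` (stmt-15917): A `p`-BASIS CONTAINING A PRESCRIBED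
# REGULAR SYSTEM OF PARAMETERS AT A CLOSED POINT — assembly (G) of the T2 `p`-basis discharge

Support file (OURS) for PROGRAMME-clean-dim2 / T2 (`HOME/L/res-L0-w81-pv-2/g5/T2-ARCHITECTURE.md`).

**Theorem (`exists_isPBasisOver_containing_rsop`; Kimura–Niitsuma 1980, Thm. 3.4 with Thm. 3.1 /
Lemma 2.6, at a closed point, consumer-shaped).** Let `k` be a field of characteristic `p`, `O` a
regular local `k`-algebra of characteristic `p` which is generated, as a ring, by its `p`-th
powers, the image of `k` and finitely many elements (any localisation of a finitely generated
`k`-algebra is), and whose residue field `κ` is spanned over `k` by finitely many elements (a closed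
point). Then for every regular system of parameters `x_1, …, x_d` of `O` there is a `p`-basis `Γ`
of `O` over `O^p` (`IsPBasisOver`, possibly infinite) with `x_1, …, x_d ∈ Γ`.

Proof. `Γ = A ∪ {x}` where `A` lifts a `p`-basis `B` of `κ` over `κ^p` chosen as follows (F1,
`exists_maximal_pIndep`): `B ⊇ B₁` with `B₁ ⊆ k'` (the image of `k`) maximal `p`-independent and
`B ∖ B₁` among the residues of the finitely many ring generators; then `κ = κ^p[B]`.
Independence of the `Γ`-monomials over `O^p` is (A1) (`linearIndependent_monomial_rsop`, after
re-indexing, `exists_reindex_monomial`); generation `O = O^p[Γ]` is (A2)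
(`subring_eq_top_of_nakayama`), whose finiteness input is (F2)
(`exists_finset_subfield_subset_closure`: `k ⊆ k^p[A ∩ k, b_1, …, b_m]`, pulled back along the
injective map `k → κ`).

References: T. Kimura, H. Niitsuma, *Regular local ring of characteristic p and p-basis*, J. Math.
Soc. Japan 32 (1980), Thm. 3.1, Lemma 2.6, Thm. 3.4. [cite: KimuraNiitsuma1980, Thm. 3.4]
-/

noncomputable section

open IsLocalRing
open Literature.AlgebraicGeometry.Resolution Literature.RingTheory.PBasis

namespace Summit.ResolutionOfSingularities.ResolutionOfSingularities.Theorems.RadicialJung.CleanModels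

universe u v

/-! ## Re-indexing monomials in `A ∪ {x}` -/

/-- A finite family of distinct elements of `A ∪ {x_1, …, x_d}` splits as distinct elements
`a_1, …, a_m` of `A` and some of the `x_j`; the monomials in the family are monomials `a^α x^β`,
injectively in the exponent. [folklore] -/
theorem exists_reindex_monomial {R : Type u} [CommMonoid R] (p : ℕ) [NeZero p] {s d : ℕ} (b : Fin s → R)
    (hb : Function.Injective b) (SA : Set R) (x : Fin d → R)
    (hmem : ∀ i, b i ∈ SA ∪ Set.range x) :
    ∃ (m : ℕ) (a : Fin m → R), Function.Injective a ∧ (∀ l, a l ∈ SA) ∧ (∀ l, a l ∈ Set.range b) ∧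
      ∃ Φ : (Fin s → Fin p) → (Fin m → Fin p) × (Fin d → Fin p), Function.Injective Φ ∧
        ∀ n, ∏ i, b i ^ (n i : ℕ) = (∏ l, a l ^ ((Φ n).1 l : ℕ)) * ∏ j, x j ^ ((Φ n).2 j : ℕ) := by
  classical
  let TA : Finset (Fin s) := Finset.univ.filter fun i => b i ∈ SA
  have hTA : ∀ i, i ∈ TA ↔ b i ∈ SA := fun i => by simp [TA]
  let σ : Fin TA.card ≃ TA := TA.equivFin.symm
  let a : Fin TA.card → R := fun l => b (σ l).1
  -- the indices going to `x`
  let Tx := {i : Fin s // b i ∉ SA}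
  have hsel : ∀ i : Tx, ∃ j, x j = b i.1 := fun i => (hmem i.1).resolve_left i.2
  choose J hJ using hsel
  have hJinj : Function.Injective J := fun i i' h =>
    Subtype.ext (hb (by rw [← hJ i, ← hJ i', h]))
  refine ⟨TA.card, a, ?_, fun l => (hTA _).mp (σ l).2, fun l => ⟨_, rfl⟩, ?_⟩
  · intro l l' h
    exact σ.injective (Subtype.ext (hb h))
  let Φ : (Fin s → Fin p) → (Fin TA.card → Fin p) × (Fin d → Fin p) := fun n =>
    (fun l => n (σ l).1, Function.extend J (fun i => n i.1) (fun _ => 0))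
  have hΦ2 : ∀ n (i : Tx), (Φ n).2 (J i) = n i.1 := fun n i => by
    show Function.extend J (fun i => n i.1) (fun _ => 0) (J i) = n i.1
    exact hJinj.extend_apply _ _ i
  have hΦ2' : ∀ n j, (¬ ∃ i, J i = j) → (Φ n).2 j = 0 := fun n j h => by
    show Function.extend J (fun i => n i.1) (fun _ => 0) j = 0
    exact Function.extend_apply' _ _ j h
  refine ⟨Φ, ?_, ?_⟩
  · intro n n' h
    funext i
    by_cases hi : b i ∈ SA
    · have h1 := congrFun (congrArg Prod.fst h) (σ.symm ⟨i, (hTA i).mpr hi⟩)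
      simpa [Φ] using h1
    · have h2 := congrFun (congrArg Prod.snd h) (J ⟨i, hi⟩)
      rwa [hΦ2 n ⟨i, hi⟩, hΦ2 n' ⟨i, hi⟩] at h2
  · intro n
    rw [← Finset.prod_filter_mul_prod_filter_not Finset.univ (fun i => b i ∈ SA)]
    congr 1
    · -- the `A`-part
      rw [← Finset.prod_coe_sort TA, ← Fintype.prod_equiv σ (fun l => a l ^ ((Φ n).1 l : ℕ))
        (fun i : TA => b i.1 ^ (n i.1 : ℕ)) (fun l => rfl)]
    · -- the `x`-part
      have hx : ∀ j, x j ^ ((Φ n).2 j : ℕ) =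
          if j ∈ (Finset.univ : Finset Tx).image J then x j ^ ((Φ n).2 j : ℕ) else 1 := by
        intro j
        split_ifs with h
        · rfl
        · rw [hΦ2' n j (fun ⟨i, hi⟩ => h (Finset.mem_image.mpr ⟨i, Finset.mem_univ _, hi⟩)),
            Fin.val_zero, pow_zero]
      rw [Finset.prod_congr rfl fun j _ => hx j, ← Finset.prod_filter, Finset.filter_mem_eq_inter,
        Finset.univ_inter, Finset.prod_image fun i _ i' _ h => hJinj h]
      rw [← Finset.prod_coe_sort]
      refine Fintype.prod_equiv (Equiv.subtypeEquivRight fun i => by simp) _ _ fun i => ?_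
      simp only [hΦ2, hJ, Equiv.subtypeEquivRight_apply_coe]

/-! ## The `p`-basis at a closed point -/

/-- **A `p`-basis of `O` over `O^p` containing a given regular system of parameters**, for a regular
local algebra `O` of characteristic `p` over a field `k`, ring-generated by `O^p`, `k` and finitely
many elements, whose residue field is finite over `k` (Kimura–Niitsuma, Thm. 3.4 / 3.1 at a closed
point). [cite: KimuraNiitsuma1980, Thm. 3.4] -/
theorem exists_isPBasisOver_containing_rsop (p : ℕ) [Fact p.Prime] {k : Type v} [Field k]
    [CharP k p] {O : Type u} [CommRing O] [IsRegularLocalRing O] [CharP O p] [Algebra k O]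
    (hgen : ∃ s : Finset O,
      Subring.closure (Set.range (frobenius O p) ∪ Set.range (algebraMap k O) ∪ ↑s) = ⊤)
    (hfin : ∃ (n : ℕ) (e : Fin n → ResidueField O), ∀ z, ∃ c : Fin n → k,
      z = ∑ i, residue O (algebraMap k O (c i)) * e i)
    {d : ℕ} (x : Fin d → O) (hx : Ideal.span (Set.range x) = maximalIdeal O)
    (hd : ringKrullDim O = d) :
    ∃ Γ : Set O, Set.range x ⊆ Γ ∧ IsPBasisOver p (frobenius O p).range Γ := by
  classical
  have hp : p.Prime := Fact.out
  have hp1 : 1 ≤ p := hp.one_lt.le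
  haveI : NeZero p := ⟨hp.ne_zero⟩
  haveI : IsDomain O := isDomain_of_isRegularLocalRing O
  -- the residue field and the image `k'` of `k`
  let φ : k →+* ResidueField O := (residue O).comp (algebraMap k O)
  have hφ : Function.Injective φ := φ.injective
  haveI : CharP (ResidueField O) p := charP_of_injective_ringHom hφ p
  let k' : Subfield (ResidueField O) := φ.fieldRange
  have hk'mem : ∀ c : k, φ c ∈ k' := fun c => φ.mem_fieldRange_self c
  -- the empty set is `p`-independent
  have hempty : ∀ (s : ℕ) (b : Fin s → ResidueField O), Function.Injective b → (∀ i, b i ∈ (∅ : Set _)) →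
      LinearIndependent (frobenius (ResidueField O) p).range
        (fun n : Fin s → Fin p => ∏ i, b i ^ (n i : ℕ)) := by
    intro s b _ hmem
    rcases Nat.eq_zero_or_pos s with rfl | hs
    · rw [Fintype.linearIndependent_iff]
      intro g hg n
      rw [Finset.sum_eq_single n (fun n' _ hn' => absurd (Subsingleton.elim n' n) hn')
        (fun h => absurd (Finset.mem_univ n) h)] at hg
      simp only [Finset.univ_eq_empty, Finset.prod_empty, Subring.smul_def, smul_eq_mul,
        mul_one] at hg
      exact Subtype.ext hg
    · exact absurd (hmem ⟨0, hs⟩) (Set.notMem_empty _)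
  -- (F1) a maximal `p`-independent subset `B₁` of `k'`, then `B ⊇ B₁` inside `k' ∪ s̄`
  obtain ⟨B₁, -, hB₁k, hB₁ind, hk'B₁⟩ :=
    exists_maximal_pIndep p (k' : Set (ResidueField O)) ∅ (Set.empty_subset _) hempty
  obtain ⟨s, hs⟩ := hgen
  let Y₂ : Set (ResidueField O) := (k' : Set (ResidueField O)) ∪ ↑(s.image (residue O))
  obtain ⟨B, hB₁B, hBY, hBind, hY₂B⟩ :=
    exists_maximal_pIndep p Y₂ B₁ (hB₁k.trans Set.subset_union_left) hB₁ind
  -- `κ = κ^p[B]`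
  have hκgen : Subring.closure (Set.range (frobenius (ResidueField O) p) ∪ B) = ⊤ := by
    rw [eq_top_iff]
    rintro z -
    obtain ⟨o, rfl⟩ := residue_surjective z
    have ho : o ∈ Subring.closure
        (Set.range (frobenius O p) ∪ Set.range (algebraMap k O) ∪ ↑s) := hs ▸ Subring.mem_top o
    have hz : residue O o ∈ (Subring.closure
        (Set.range (frobenius O p) ∪ Set.range (algebraMap k O) ∪ ↑s)).map (residue O) :=
      ⟨o, ho, rfl⟩
    rw [RingHom.map_closure] at hz
    refine (Subring.closure_le.mpr ?_) hz
    rintro _ ⟨o', ho', rfl⟩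
    rcases ho' with (⟨w, rfl⟩ | ⟨c, rfl⟩) | ho'
    · refine Subring.subset_closure (Or.inl ⟨residue O w, ?_⟩)
      rw [frobenius_def, frobenius_def, map_pow]
    · exact hY₂B (Or.inl (hk'mem c))
    · exact hY₂B (Or.inr (by simpa using Finset.mem_image_of_mem (residue O) ho'))
  -- lifting `B` to `O`
  let pre : ResidueField O → k := fun z =>
    if h : z ∈ k' then (RingHom.mem_fieldRange.mp h).choose else 0
  have hpre : ∀ z ∈ (k' : Set (ResidueField O)), φ (pre z) = z := by
    intro z hz
    simp only [pre, dif_pos (show z ∈ k' from hz)]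
    exact (RingHom.mem_fieldRange.mp hz).choose_spec
  let lift : ResidueField O → O := fun z =>
    if z ∈ k' then algebraMap k O (pre z)
    else if h : ∃ o, o ∈ s ∧ residue O o = z then h.choose else 0
  have hlift_k : ∀ z ∈ (k' : Set (ResidueField O)), lift z = algebraMap k O (pre z) := fun z hz => by
    simp only [lift, if_pos (show z ∈ k' from hz)]
  have hlift : ∀ z ∈ Y₂, residue O (lift z) = z := by
    intro z hz
    by_cases hzk : z ∈ k'
    · rw [hlift_k z hzk]; exact hpre z hzk
    · have h : ∃ o, o ∈ s ∧ residue O o = z := by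
        rcases hz with hz | hz
        · exact absurd hz hzk
        · obtain ⟨o, ho, hoz⟩ := Finset.mem_image.mp (by simpa using hz)
          exact ⟨o, ho, hoz⟩
      simp only [lift, if_neg hzk, dif_pos h]
      exact h.choose_spec.2
  let A : Set O := lift '' B
  have hresA : residue O '' A = B := by
    rw [Set.image_image]
    ext z
    constructor
    · rintro ⟨z', hz', rfl⟩
      show residue O (lift z') ∈ B
      rw [hlift z' (hBY hz')]
      exact hz'
    · intro hz
      exact ⟨z, hz, hlift z (hBY hz)⟩
  -- (F2): `k ⊆ k^p[A ∩ k, b]` for finitely many `b`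
  obtain ⟨n, e, he⟩ := hfin
  have he' : ∀ z : ResidueField O, ∃ c : Fin n → ResidueField O, (∀ i, c i ∈ k') ∧ z = ∑ i, c i * e i := by
    intro z
    obtain ⟨c, rfl⟩ := he z
    exact ⟨fun i => φ (c i), fun i => hk'mem (c i), rfl⟩
  obtain ⟨bκ, hbκk, hk'cl⟩ := exists_finset_subfield_subset_closure p k' e he' B₁ hB₁k hk'B₁
  let bO : Finset O := bκ.image fun z => algebraMap k O (pre z)
  have hkO : ∀ c : k, algebraMap k O c ∈
      Subring.closure (Set.range (frobenius O p) ∪ A ∪ ↑bO) := by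
    intro c
    -- pull back to `k`
    let Sk : Set k := Set.range (frobenius k p) ∪ pre '' B₁ ∪ pre '' ↑bκ
    have himg : frobenius (ResidueField O) p '' (k' : Set (ResidueField O)) ∪ B₁ ∪ ↑bκ ⊆ φ '' Sk := by
      rintro z ((⟨w, hw, rfl⟩ | hz) | hz)
      · obtain ⟨c', rfl⟩ := RingHom.mem_fieldRange.mp hw
        exact ⟨c' ^ p, Or.inl (Or.inl ⟨c', frobenius_def _ _⟩), by rw [map_pow, frobenius_def]⟩
      · exact ⟨pre z, Or.inl (Or.inr ⟨z, hz, rfl⟩), hpre z (hB₁k hz)⟩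
      · exact ⟨pre z, Or.inr ⟨z, hz, rfl⟩, hpre z (hbκk hz)⟩
    have hc : φ c ∈ Subring.closure (φ '' Sk) :=
      Subring.closure_mono himg (hk'cl (hk'mem c))
    rw [← RingHom.map_closure] at hc
    obtain ⟨c', hc', hcc'⟩ := Subring.mem_map.mp hc
    have hcS : c ∈ Subring.closure Sk := by rw [← hφ hcc']; exact hc'
    -- push to `O`
    have hO : algebraMap k O c ∈ (Subring.closure Sk).map (algebraMap k O) := ⟨c, hcS, rfl⟩
    rw [RingHom.map_closure] at hO
    refine (Subring.closure_le.mpr ?_) hO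
    rintro _ ⟨c₀, hc₀, rfl⟩
    rcases hc₀ with (⟨w, rfl⟩ | ⟨z, hz, rfl⟩) | ⟨z, hz, rfl⟩
    · refine Subring.subset_closure (Or.inl (Or.inl ⟨algebraMap k O w, ?_⟩))
      rw [frobenius_def, frobenius_def, map_pow]
    · refine Subring.subset_closure (Or.inl (Or.inr ?_))
      rw [← hlift_k z (hB₁k hz)]
      exact ⟨z, hB₁B hz, rfl⟩
    · exact Subring.subset_closure (Or.inr (Finset.mem_coe.mpr
        (Finset.mem_image_of_mem (fun z => algebraMap k O (pre z)) hz)))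
  -- (A2) generation
  let Γ : Set O := A ∪ Set.range x
  let T : Subring O := (Algebra.adjoin (frobenius O p).range Γ).toSubring
  have hT : T = Subring.closure (Set.range (frobenius O p) ∪ Γ) := adjoin_frobenius_toSubring Γ
  have hTpow : ∀ r : O, r ^ p ∈ T := fun r => by
    rw [hT]; exact Subring.subset_closure (Or.inl ⟨r, frobenius_def _ _⟩)
  have hAT : A ⊆ T := fun a ha => by rw [hT]; exact Subring.subset_closure (Or.inr (Or.inl ha))
  have hxT : ∀ i, x i ∈ T := fun i => by
    rw [hT]; exact Subring.subset_closure (Or.inr (Or.inr ⟨i, rfl⟩))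
  have hκA : Subring.closure (Set.range (frobenius (ResidueField O) p) ∪ residue O '' A) = ⊤ := by
    rw [hresA]; exact hκgen
  have hres : ∀ r : O, ∃ t ∈ T, r - t ∈ maximalIdeal O :=
    exists_sub_mem_maximalIdeal_of_closure_residue_eq_top T A hAT hκA hTpow
  have hfrobT : ∀ w : O, frobenius O p w ∈ (T : Set O) := fun w => by
    rw [SetLike.mem_coe, frobenius_def]; exact hTpow w
  have hgenT : Subring.closure ((T : Set O) ∪ ↑(s ∪ bO)) = ⊤ := by
    rw [eq_top_iff, ← hs, Subring.closure_le]
    rintro r ((⟨w, rfl⟩ | ⟨c, rfl⟩) | hr)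
    · exact Subring.subset_closure (Or.inl (hfrobT w))
    · refine (Subring.closure_le.mpr ?_ : Subring.closure (Set.range (frobenius O p) ∪ A ∪ ↑bO) ≤ _)
        (hkO c)
      rintro r' ((⟨w, rfl⟩ | hr') | hr')
      · exact Subring.subset_closure (Or.inl (hfrobT w))
      · exact Subring.subset_closure (Or.inl (hAT hr'))
      · exact Subring.subset_closure (Or.inr (Finset.mem_coe.mpr
          (Finset.mem_union_right _ (Finset.mem_coe.mp hr'))))
    · exact Subring.subset_closure (Or.inr (Finset.mem_coe.mpr
        (Finset.mem_union_left _ (Finset.mem_coe.mp hr))))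
  have hTtop : T = ⊤ := subring_eq_top_of_nakayama hp1 T hTpow hres x hxT hx (s ∪ bO) hgenT
  have hadj : Algebra.adjoin (frobenius O p).range Γ = ⊤ := Algebra.toSubring_eq_top.mp hTtop
  -- (A1) independence
  have hd' : (maximalIdeal O).spanFinrank = d := by
    have := spanFinrank_eq_of_ringKrullDim_eq (R := O) (r := d) (e := 0) (by rw [Nat.add_zero]; exact hd)
    simpa using this
  refine ⟨Γ, Set.subset_union_right, hadj, ?_⟩
  intro s₀ b hb hbΓ
  obtain ⟨m, a, ha, haA, -, Φ, hΦ, hfam⟩ :=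
    exists_reindex_monomial p b hb A x hbΓ
  -- residues of `a` are distinct elements of `B`
  have haB : ∀ l, residue O (a l) ∈ B := by
    intro l
    obtain ⟨z, hz, hza⟩ := haA l
    rw [← hza, hlift z (hBY hz)]; exact hz
  have hainj : Function.Injective (fun l => residue O (a l)) := by
    intro l l' h
    obtain ⟨z, hz, hza⟩ := haA l
    obtain ⟨z', hz', hza'⟩ := haA l'
    apply ha
    have h1 : residue O (a l) = z := by rw [← hza]; exact hlift z (hBY hz)
    have h2 : residue O (a l') = z' := by rw [← hza']; exact hlift z' (hBY hz')
    have hzz : z = z' := by rw [← h1, ← h2]; exact h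
    rw [← hza, ← hza', hzz]
  have hali := linearIndependent_monomial_rsop hd' x hx a (hBind m _ hainj haB)
  have hcomp := hali.comp Φ hΦ
  convert hcomp using 1
  funext n₀
  rw [Function.comp_apply]
  exact hfam n₀

end Summit.ResolutionOfSingularities.ResolutionOfSingularities.Theorems.RadicialJung.CleanModels
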